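import Literature.Combinatorics.SimpleGraph.HamiltonianIteratedSubstitution
import Mathlib.Algebra.BigOperators.Ring.Finset
import Mathlib.Tactic.Ring
import HarnessLib

/-!
# Gadget substitution for Hamiltonian-path counts, X: constraints inside the gadget (nested substitution)

Continuation of `HamiltonianGadgetSubstitutionCount.lean` (local replacement, Garey–Johnson 1979,
§3.2.2). The counting identity there,
`#Ham(M', R, F) = Σ_{U ⊆ S} N(U) · #Ham(M, R ∪ U, F ∪ (S \ U))`, allows required / forbidden edges
`R, F` only among the OLD vertices. When gadgets are substituted into gadgets — the way
Garey–Johnson–Tarjan 1976 cross two exclusive-or lines: the crossed line keeps its ladder but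
every rung carries a two-node cycle, and the crossing line is cut into exclusive-or gadgets whose
slots are the edges of these cycles (Liśkiewicz–Ogihara–Toda 2003, §3, Fig. 2 (b): "XOR-gadgets can
be crossed without losing planarity … four XOR-gadgets are added") — the outer substitution hands
constraints on edges INSIDE an earlier gadget down to that gadget. This file proves the identity
with such constraints:

* `UsesF f U x` — some strand of the cover `f` (realising `U`) uses the edge `x`;
  `coverSetRF GX VX U RX FX`, `coverCountRF` — the covers realising `U` whose strands use every
  edge of `RX` and no edge of `FX` (the **refined census** `N(U; RX, FX)`; `RX = FX = ∅` gives
  `coverSet` / `coverCount` back, `coverSetRF_empty`);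
* `pair_infix_expand_iff` — two gadget vertices are consecutive in an expansion iff they are
  consecutive in an inserted list; hence under the substitution bijection the edges inside `VX`
  used by a Hamiltonian path of `M'` are exactly the edges used by the strands of its cover
  (`Substitution.uses_expand_iff_of_mem`);
* **`Substitution.hamCountRF_eq_sum_refined`**: for `RX, FX` sets of edges with both ends in `VX`,

  `hamCountRF M' (V ∪ VX) s t (R ∪ RX) (F ∪ FX)
     = Σ_{U ⊆ S} coverCountRF GX VX U RX FX * hamCountRF M V s t (R ∪ U) (F ∪ (S \ U))`;
* **`GadgetFamily.Valid.hamCountRF_graphUpTo_refined`** — the same for a valid gadget family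
  (`HamiltonianIteratedSubstitution.lean`): constraints inside the gadgets are distributed to the
  refined censuses of the gadgets containing them (`innerPart`),

  `hamCountRF (graphUpTo k) (vertsUpTo k) s t (R ∪ RX) (F ∪ FX)
     = Σ_{U ⊆ slots<k} (∏_{i<k} coverCountRF (GX i) (VX i) (U ∩ S i) (innerPart (VX i) RX) (innerPart (VX i) FX))
         · hamCountRF M V s t (R ∪ U) (F ∪ (slots<k \ U))`.

  This is the bookkeeping for a two-stage substitution (first the crossed lines with their
  two-node cycles, then the exclusive-or gadgets of the crossing lines into those cycles).

## References

* M. R. Garey, D. S. Johnson, *Computers and Intractability*, Freeman 1979, §3.2.2 (local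
  replacement).
* M. R. Garey, D. S. Johnson, R. E. Tarjan, *The planar Hamiltonian circuit problem is
  NP-complete*, SIAM J. Comput. 5 (1976) 704–714 (crossing of exclusive-or lines).
* M. Liśkiewicz, M. Ogihara, S. Toda, TCS 304 (2003) 129–156, §3, Fig. 2 (b) (report version:
  ECCC TR01-061, rev. 2, p. 8).
-/

namespace Literature.Combinatorics.SimpleGraph

open scoped Classical

variable {α : Type*} [DecidableEq α]

/-! ### Consecutive pairs in an append and in an expansion -/

omit [DecidableEq α] in
/-- A consecutive pair of an append lies in the left part, in the right part, or straddles the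
junction. [folklore] -/
theorem pair_infix_append {x y : α} : ∀ {L₁ L₂ : List α}, [x, y] <:+: L₁ ++ L₂ →
    [x, y] <:+: L₁ ∨ [x, y] <:+: L₂ ∨ (L₁.getLast? = some x ∧ L₂.head? = some y)
  | [], L₂, h => Or.inr (Or.inl (by simpa using h))
  | a :: L₁, L₂, h => by
    rw [List.cons_append, List.infix_cons_iff] at h
    rcases h with h | h
    · -- `[x, y]` is a prefix of `a :: (L₁ ++ L₂)`
      rw [List.cons_prefix_cons] at h
      obtain ⟨rfl, hy⟩ := h
      rcases L₁ with _ | ⟨b, L₁⟩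
      · refine Or.inr (Or.inr ⟨rfl, ?_⟩)
        simp only [List.nil_append] at hy
        rcases L₂ with _ | ⟨c, L₂⟩
        · simpa using hy.length_le
        · rw [List.cons_prefix_cons] at hy
          rw [hy.1]; rfl
      · rw [List.cons_append, List.cons_prefix_cons] at hy
        obtain ⟨rfl, -⟩ := hy
        exact Or.inl ⟨[], L₁, rfl⟩
    · rcases pair_infix_append h with h | h | ⟨h1, h2⟩
      · left
        obtain ⟨s, t, hst⟩ := h
        exact ⟨a :: s, t, by rw [← hst]; simp⟩
      · exact Or.inr (Or.inl h)
      · refine Or.inr (Or.inr ⟨?_, h2⟩)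
        rcases L₁ with _ | ⟨b, L₁⟩
        · simp at h1
        · rw [List.getLast?_cons_cons]; exact h1

omit [DecidableEq α] in
/-- **Two vertices of `VX` are consecutive in an expansion of a list outside `VX` by lists inside
`VX` iff they are consecutive in one of the inserted lists.** [folklore] -/
theorem pair_infix_expand_iff {VX : Finset α} {ι : α → α → List α} (hι : ∀ a b, ∀ x ∈ ι a b, x ∈ VX)
    {x y : α} (hx : x ∈ VX) (hy : y ∈ VX) :
    ∀ {l : List α}, (∀ z ∈ l, z ∉ VX) →
      ([x, y] <:+: expand ι l ↔ ∃ a b, [a, b] <:+: l ∧ [x, y] <:+: ι a b)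
  | [], _ => by
    simp only [expand_nil]
    constructor
    · intro h; simpa using h.length_le
    · rintro ⟨a, b, h, -⟩; simpa using h.length_le
  | [c], _ => by
    simp only [expand_singleton]
    constructor
    · intro h; simpa using h.length_le
    · rintro ⟨a, b, h, -⟩; simpa using h.length_le
  | c :: d :: l, hl => by
    have hc : c ∉ VX := hl c (by simp)
    have hd : d ∉ VX := hl d (by simp)
    have ih := pair_infix_expand_iff hι hx hy (l := d :: l) (fun z hz => hl z (List.mem_cons_of_mem _ hz))
    rw [expand_cons_cons]
    constructor
    · intro h
      rw [List.infix_cons_iff] at h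
      rcases h with h | h
      · rw [List.cons_prefix_cons] at h
        exact absurd hx (h.1 ▸ hc)
      · rcases pair_infix_append h with h | h | ⟨-, h2⟩
        · exact ⟨c, d, ⟨[], l, rfl⟩, h⟩
        · obtain ⟨a, b, ⟨s, t, hst⟩, hab⟩ := ih.1 h
          exact ⟨a, b, ⟨c :: s, t, by rw [← hst]; simp⟩, hab⟩
        · rw [head?_expand] at h2
          simp only [List.head?_cons, Option.some.injEq] at h2
          exact absurd hy (h2 ▸ hd)
    · rintro ⟨a, b, hab, hxy⟩
      obtain ⟨E₁, E₂, hE, -⟩ := expand_eq_append_of_infix ι hab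
      rw [← expand_cons_cons, hE]
      obtain ⟨s, t, hst⟩ := hxy
      exact ⟨E₁ ++ a :: s, t ++ b :: E₂, by rw [← hst]; simp⟩

/-! ### Covers with required and forbidden inner edges -/

omit [DecidableEq α] in
/-- **Some strand of the family `f` realising `U` uses the edge `x`.** [folklore] -/
def UsesF (f : α × α → List α) (U : Finset (α × α)) (x : α × α) : Prop :=
  ∃ e ∈ U, Uses (f e) x

/-- **The covers realising `U` whose strands use every edge of `RX` and no edge of `FX`** (edges
inside the gadget). [cite: GareyJohnson1979, §3.2.2 (local replacement)] -/
def coverSetRF (GX : _root_.SimpleGraph α) (VX : Finset α) (U RX FX : Finset (α × α)) :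
    Set (α × α → List α) :=
  {f | IsCover GX VX U f ∧ (∀ x ∈ RX, UsesF f U x) ∧ ∀ x ∈ FX, ¬ UsesF f U x}

/-- **The refined census `N(U; RX, FX)`**: the number of covers realising `U` that use every edge of
`RX` and no edge of `FX`. [cite: GareyJohnson1979, §3.2.2 (local replacement)] -/
noncomputable def coverCountRF (GX : _root_.SimpleGraph α) (VX : Finset α) (U RX FX : Finset (α × α)) : ℕ :=
  (coverSetRF GX VX U RX FX).ncard

omit [DecidableEq α] in
/-- Refined covers are covers. [folklore] -/
theorem coverSetRF_subset (GX : _root_.SimpleGraph α) (VX : Finset α) (U RX FX : Finset (α × α)) :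
    coverSetRF GX VX U RX FX ⊆ coverSet GX VX U :=
  fun _ hf => hf.1

omit [DecidableEq α] in
/-- With no inner constraints the refined covers are all covers. [folklore] -/
theorem coverSetRF_empty (GX : _root_.SimpleGraph α) (VX : Finset α) (U : Finset (α × α)) :
    coverSetRF GX VX U ∅ ∅ = coverSet GX VX U := by
  ext f
  simp [coverSetRF, coverSet]

omit [DecidableEq α] in
/-- With no inner constraints the refined census is the census. [folklore] -/
theorem coverCountRF_empty (GX : _root_.SimpleGraph α) (VX : Finset α) (U : Finset (α × α)) :
    coverCountRF GX VX U ∅ ∅ = coverCount GX VX U := by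
  rw [coverCountRF, coverSetRF_empty, coverCount]

/-- The refined covers form a finite set. [folklore] -/
theorem coverSetRF_finite (GX : _root_.SimpleGraph α) (VX : Finset α) (U RX FX : Finset (α × α)) :
    (coverSetRF GX VX U RX FX).Finite :=
  (coverSet_finite GX VX U).subset (coverSetRF_subset GX VX U RX FX)

/-- Enlarging the inner constraints shrinks the refined census. [folklore] -/
theorem coverCountRF_le_coverCount (GX : _root_.SimpleGraph α) (VX : Finset α) (U RX FX : Finset (α × α)) :
    coverCountRF GX VX U RX FX ≤ coverCount GX VX U :=
  Set.ncard_le_ncard (coverSetRF_subset GX VX U RX FX) (coverSet_finite GX VX U)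

namespace Substitution

variable {M M' GX : _root_.SimpleGraph α} {V VX : Finset α} {S : Finset (α × α)}
  (h : Substitution M V S GX VX M')
include h

/-! ### Inner edges used by an expansion -/

/-- **Under the substitution bijection, the edges inside `VX` used by the expanded path are the
edges used by the strands of the inserted cover.** [cite: GareyJohnson1979, §3.2.2] -/
theorem uses_expand_iff_of_mem {s t : α} {U R F : Finset (α × α)} {f : α × α → List α} {l : List α}
    (hU : U ⊆ S) (hf : IsCover GX VX U f) (hl : l ∈ hamSetRF M V s t (R ∪ U) (F ∪ (S \ U)))
    {x : α × α} (hx1 : x.1 ∈ VX) (hx2 : x.2 ∈ VX) :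
    Uses (expand (orient f) l) x ↔ UsesF f U x := by
  have hlV : ∀ z ∈ l, z ∉ VX := fun z hz => h.not_mem_VX_of_mem_V (hl.1.mem_iff.1 hz)
  have hι := orient_subset hf
  -- which slot an inserted nonempty piece belongs to
  have key : ∀ a b (p q : α), [p, q] <:+: orient f a b → ∃ e ∈ U, Uses (f e) (p, q) := by
    intro a b p q hpq
    by_cases hne : f (a, b) ≠ []
    · have hab : (a, b) ∈ U := by by_contra hc; exact hne (hf.2.1 _ hc)
      rw [orient, if_pos hne] at hpq
      exact ⟨(a, b), hab, Or.inl hpq⟩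
    · rw [orient, if_neg hne] at hpq
      have hne' : f (b, a) ≠ [] := by
        intro h0; rw [h0] at hpq; simpa using hpq.length_le
      have hba : (b, a) ∈ U := by by_contra hc; exact hne' (hf.2.1 _ hc)
      refine ⟨(b, a), hba, ?_⟩
      have : Uses (f (b, a)).reverse (p, q) := Or.inl hpq
      exact uses_reverse.1 this
  constructor
  · rintro (hpq | hpq)
    · obtain ⟨a, b, -, hab⟩ := (pair_infix_expand_iff hι hx1 hx2 hlV).1 hpq
      exact key a b _ _ hab
    · obtain ⟨a, b, -, hab⟩ := (pair_infix_expand_iff hι hx2 hx1 hlV).1 hpq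
      obtain ⟨e, he, hu⟩ := key a b _ _ hab
      exact ⟨e, he, uses_swap.1 hu⟩
  · rintro ⟨e, heU, hu⟩
    have hne : f e ≠ [] := (hf.1 e heU).1
    -- the base path uses the slot `e`, in one of the two directions
    rcases hl.2.1 e (Finset.mem_union_right _ heU) with hinf | hinf
    · have ho : orient f e.1 e.2 = f e := by rw [orient, if_pos hne]
      rcases hu with hpq | hpq
      · exact Or.inl ((pair_infix_expand_iff hι hx1 hx2 hlV).2 ⟨e.1, e.2, hinf, by rw [ho]; exact hpq⟩)
      · exact Or.inr ((pair_infix_expand_iff hι hx2 hx1 hlV).2 ⟨e.1, e.2, hinf, by rw [ho]; exact hpq⟩)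
    · have hswap : f (e.2, e.1) = [] := hf.2.1 _ fun he' => h.not_mem_swap (hU heU) (hU he')
      have ho : orient f e.2 e.1 = (f e).reverse := by
        rw [orient, hswap, if_neg (by simp)]
      have hu' : Uses (f e).reverse x := uses_reverse.2 hu
      rcases hu' with hpq | hpq
      · exact Or.inl ((pair_infix_expand_iff hι hx1 hx2 hlV).2 ⟨e.2, e.1, hinf, by rw [ho]; exact hpq⟩)
      · exact Or.inr ((pair_infix_expand_iff hι hx2 hx1 hlV).2 ⟨e.2, e.1, hinf, by rw [ho]; exact hpq⟩)

/-! ### The refined counting identity -/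

/-- **Gadget substitution for Hamiltonian-path counts with constraints inside the gadget**: for
end points in `V`, constraints `R, F` on non-slot edges inside `V` and constraints `RX, FX` on
edges inside `VX`,
`#Ham(M', R ∪ RX, F ∪ FX) = Σ_{U ⊆ S} N(U; RX, FX) · #Ham(M, R ∪ U, F ∪ (S \ U))` — the form in which
an exclusive-or gadget substituted into the two-node cycles of a crossed exclusive-or line
constrains that line's census (Garey–Johnson–Tarjan's crossing, LOT2003 Fig. 2 (b)).
[cite: GareyJohnson1979, §3.2.2 (local replacement)] -/
theorem hamCountRF_eq_sum_refined {s t : α} (hsV : s ∈ V) (htV : t ∈ V) {R F RX FX : Finset (α × α)}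
    (hR : ∀ e ∈ R, e.1 ∈ V ∧ e.2 ∈ V ∧ ¬ slotOf S e.1 e.2)
    (hF : ∀ e ∈ F, e.1 ∈ V ∧ e.2 ∈ V ∧ ¬ slotOf S e.1 e.2)
    (hRX : ∀ x ∈ RX, x.1 ∈ VX ∧ x.2 ∈ VX) (hFX : ∀ x ∈ FX, x.1 ∈ VX ∧ x.2 ∈ VX) :
    hamCountRF M' (V ∪ VX) s t (R ∪ RX) (F ∪ FX) =
      ∑ U ∈ S.powerset, coverCountRF GX VX U RX FX * hamCountRF M V s t (R ∪ U) (F ∪ (S \ U)) := by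
  have hF' : ∀ e ∈ F, e.1 ∈ V ∧ e.2 ∈ V := fun e he => ⟨(hF e he).1, (hF e he).2.1⟩
  have hR' : ∀ e ∈ R, e.1 ∈ V ∧ e.2 ∈ V := fun e he => ⟨(hR e he).1, (hR e he).2.1⟩
  set A := hamSetRF M' (V ∪ VX) s t (R ∪ RX) (F ∪ FX) with hA
  set B : Finset (α × α) → Set ((α × α → List α) × List α) := fun U =>
    coverSetRF GX VX U RX FX ×ˢ hamSetRF M V s t (R ∪ U) (F ∪ (S \ U)) with hB
  set Ψ : (α × α → List α) × List α → List α := fun p => expand (orient p.1) p.2 with hΨ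
  have himg : ∀ U ∈ S.powerset, Ψ '' B U ⊆ A := by
    rintro U hU _ ⟨⟨f, l⟩, ⟨hf, hl⟩, rfl⟩
    have hU' := Finset.mem_powerset.1 hU
    dsimp only at hf hl
    have h0 := h.expand_mem hU' hf.1 hR hF' hl
    refine ⟨h0.1, fun e he => ?_, fun e he => ?_⟩
    · rcases Finset.mem_union.1 he with he | he
      · exact h0.2.1 e he
      · exact (h.uses_expand_iff_of_mem hU' hf.1 hl (hRX e he).1 (hRX e he).2).2 (hf.2.1 e he)
    · rcases Finset.mem_union.1 he with he | he
      · exact h0.2.2 e he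
      · exact fun hu => hf.2.2 e he ((h.uses_expand_iff_of_mem hU' hf.1 hl (hFX e he).1 (hFX e he).2).1 hu)
  have hinj : ∀ U ∈ S.powerset, Set.InjOn Ψ (B U) := by
    rintro U hU ⟨f, l⟩ ⟨hf, hl⟩ ⟨f', l'⟩ ⟨hf', hl'⟩ heq
    have hU' := Finset.mem_powerset.1 hU
    dsimp only at hf hl hf' hl'
    simp only [hΨ] at heq
    have h1 : l = l' := by
      rw [← h.contract_expand_orient hf.1 hl, ← h.contract_expand_orient hf'.1 hl', heq]
    have h2 : f = f' := by
      rw [← h.segFamily_expand hU' hf.1 hR hF' hl, ← h.segFamily_expand hU' hf'.1 hR hF' hl', heq]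
    rw [h1, h2]
  have hused : ∀ U ∈ S.powerset, ∀ l' ∈ Ψ '' B U, usedSlots S VX l' = U := by
    rintro U hU _ ⟨⟨f, l⟩, ⟨hf, hl⟩, rfl⟩
    exact h.usedSlots_expand (Finset.mem_powerset.1 hU) hf.1 hl
  have hcover : A = ⋃ U ∈ S.powerset, Ψ '' B U := by
    ext l'
    simp only [Set.mem_iUnion]
    constructor
    · intro hl'
      have hl'0 : l' ∈ hamSetRF M' (V ∪ VX) s t R F :=
        hamSetRF_mono Finset.subset_union_left Finset.subset_union_left hl'
      have hfc : IsCover GX VX (usedSlots S VX l') (segFamily S VX l') := h.segFamily_isCover hsV htV hl'.1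
      have hlc : contract VX l' ∈ hamSetRF M V s t (R ∪ usedSlots S VX l') (F ∪ (S \ usedSlots S VX l')) :=
        h.contract_mem hsV htV hR' (fun e he => (hF e he).2.2) hl'0
      have hre : expand (orient (segFamily S VX l')) (contract VX l') = l' :=
        h.expand_segFamily_contract hsV htV hl'.1
      refine ⟨usedSlots S VX l', Finset.mem_powerset.2 (usedSlots_subset l'),
        ⟨(segFamily S VX l', contract VX l'), ⟨⟨hfc, fun x hx => ?_, fun x hx hu => ?_⟩, hlc⟩, hre⟩⟩
      · have hux : Uses l' x := hl'.2.1 x (Finset.mem_union_right _ hx)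
        rw [← hre] at hux
        exact (h.uses_expand_iff_of_mem (usedSlots_subset l') hfc hlc (hRX x hx).1 (hRX x hx).2).1 hux
      · have hux : Uses l' x := by
          rw [← hre]
          exact (h.uses_expand_iff_of_mem (usedSlots_subset l') hfc hlc (hFX x hx).1 (hFX x hx).2).2 hu
        exact hl'.2.2 x (Finset.mem_union_right _ hx) hux
    · rintro ⟨U, hU, hl'⟩
      exact himg U hU hl'
  have hdis : ∀ U ∈ S.powerset, ∀ U' ∈ S.powerset, U ≠ U' → Disjoint (Ψ '' B U) (Ψ '' B U') := by
    intro U hU U' hU' hne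
    rw [Set.disjoint_left]
    intro l' h1 h2
    exact hne ((hused U hU l' h1).symm.trans (hused U' hU' l' h2))
  have hfin : ∀ U ∈ S.powerset, (Ψ '' B U).Finite := fun U hU =>
    (hamSetRF_finite M' (V ∪ VX) s t (R ∪ RX) (F ∪ FX)).subset (himg U hU)
  calc hamCountRF M' (V ∪ VX) s t (R ∪ RX) (F ∪ FX) = A.ncard := rfl
    _ = (⋃ U ∈ S.powerset, Ψ '' B U).ncard := by rw [hcover]
    _ = ∑ U ∈ S.powerset, (Ψ '' B U).ncard := ncard_biUnion_of_disjoint _ _ hfin hdis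
    _ = ∑ U ∈ S.powerset, (B U).ncard := Finset.sum_congr rfl fun U hU => (hinj U hU).ncard_image
    _ = ∑ U ∈ S.powerset, coverCountRF GX VX U RX FX * hamCountRF M V s t (R ∪ U) (F ∪ (S \ U)) :=
      Finset.sum_congr rfl fun U _ => Set.ncard_prod

/-- The unrefined identity is the case `RX = FX = ∅` (consistency check with
`hamCountRF_eq_sum`). [cite: GareyJohnson1979, §3.2.2] -/
theorem hamCountRF_eq_sum_refined_empty {s t : α} (hsV : s ∈ V) (htV : t ∈ V) {R F : Finset (α × α)}
    (hR : ∀ e ∈ R, e.1 ∈ V ∧ e.2 ∈ V ∧ ¬ slotOf S e.1 e.2)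
    (hF : ∀ e ∈ F, e.1 ∈ V ∧ e.2 ∈ V ∧ ¬ slotOf S e.1 e.2) :
    hamCountRF M' (V ∪ VX) s t R F =
      ∑ U ∈ S.powerset, coverCountRF GX VX U ∅ ∅ * hamCountRF M V s t (R ∪ U) (F ∪ (S \ U)) := by
  have := h.hamCountRF_eq_sum_refined hsV htV (RX := ∅) (FX := ∅) hR hF (by simp) (by simp)
  simpa using this

end Substitution


/-! ### Several gadgets: distributing inner constraints to the gadgets -/

/-- **The part of a constraint set inside the vertex set `X`**: the edges with both ends in `X`.
[folklore] -/
def innerPart (X : Finset α) (RX : Finset (α × α)) : Finset (α × α) :=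
  RX.filter fun x => x.1 ∈ X ∧ x.2 ∈ X

/-- Membership in the inner part. [folklore] -/
theorem mem_innerPart {X : Finset α} {RX : Finset (α × α)} {x : α × α} :
    x ∈ innerPart X RX ↔ x ∈ RX ∧ x.1 ∈ X ∧ x.2 ∈ X := by
  simp [innerPart]

namespace GadgetFamily

variable {M : _root_.SimpleGraph α} {V : Finset α} {𝒢 : GadgetFamily α}

/-- **The refined counting identity for several gadgets**: constraints `R, F` on non-slot edges of
the base graph and `RX, FX` on edges inside the gadgets; each gadget's census is refined by the
constraints inside it. [cite: GareyJohnson1979, §3.2.2; LiskiewiczOgiharaToda2003, §3 (Fig. 2 (b))] -/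
theorem Valid.hamCountRF_graphUpTo_refined {n : ℕ} (hv : Valid M V 𝒢 n) {s t : α} (hs : s ∈ V) (ht : t ∈ V) :
    ∀ k ≤ n, ∀ R F RX FX : Finset (α × α),
      (∀ e ∈ R, e.1 ∈ V ∧ e.2 ∈ V ∧ ∀ i < k, ¬ slotOf (𝒢.S i) e.1 e.2) →
      (∀ e ∈ F, e.1 ∈ V ∧ e.2 ∈ V ∧ ∀ i < k, ¬ slotOf (𝒢.S i) e.1 e.2) →
      (∀ x ∈ RX, ∃ i < k, x.1 ∈ 𝒢.VX i ∧ x.2 ∈ 𝒢.VX i) →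
      (∀ x ∈ FX, ∃ i < k, x.1 ∈ 𝒢.VX i ∧ x.2 ∈ 𝒢.VX i) →
      hamCountRF (graphUpTo M V 𝒢 k) (vertsUpTo V 𝒢 k) s t (R ∪ RX) (F ∪ FX) =
        ∑ U ∈ (slotsBelow 𝒢 k).powerset,
          (∏ i ∈ Finset.range k, coverCountRF (𝒢.GX i) (𝒢.VX i) (U ∩ 𝒢.S i)
              (innerPart (𝒢.VX i) RX) (innerPart (𝒢.VX i) FX)) *
            hamCountRF M V s t (R ∪ U) (F ∪ (slotsBelow 𝒢 k \ U)) := by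
  intro k
  induction k with
  | zero =>
    intro _ R F RX FX _ _ hRX hFX
    have hRX0 : RX = ∅ := Finset.eq_empty_of_forall_notMem fun x hx => by
      obtain ⟨i, hi, -⟩ := hRX x hx; exact absurd hi (Nat.not_lt_zero i)
    have hFX0 : FX = ∅ := Finset.eq_empty_of_forall_notMem fun x hx => by
      obtain ⟨i, hi, -⟩ := hFX x hx; exact absurd hi (Nat.not_lt_zero i)
    subst hRX0; subst hFX0
    have hV : vertsUpTo V 𝒢 0 = V := by simp [vertsUpTo]
    have hS : slotsBelow 𝒢 0 = ∅ := by simp [slotsBelow]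
    rw [hV, hS, Finset.powerset_empty, Finset.sum_singleton, Finset.range_zero, Finset.prod_empty, one_mul]
    simp only [Finset.union_empty, Finset.empty_sdiff]
    rw [hamCountRF, hamCountRF, hamSetRF_congr (G' := M) (fun a ha b hb => ?_)]
    simp [graphUpTo, ha, hb]
  | succ k ih =>
    intro hk R F RX FX hR hF hRX hFX
    have hk' : k < n := hk
    have hsub := hv.substitution hk'
    -- split the inner constraints: inside gadget `k`, or inside an earlier gadget
    set RXk := innerPart (𝒢.VX k) RX with hRXk
    set FXk := innerPart (𝒢.VX k) FX with hFXk
    set RXl := RX \ RXk with hRXl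
    set FXl := FX \ FXk with hFXl
    -- an inner edge not inside gadget `k` is inside an earlier gadget
    have hearly : ∀ X : Finset (α × α), (∀ x ∈ X, ∃ i < k + 1, x.1 ∈ 𝒢.VX i ∧ x.2 ∈ 𝒢.VX i) →
        ∀ x ∈ X \ innerPart (𝒢.VX k) X, ∃ i < k, x.1 ∈ 𝒢.VX i ∧ x.2 ∈ 𝒢.VX i := by
      intro X hX x hx
      obtain ⟨hxX, hxn⟩ := Finset.mem_sdiff.1 hx
      obtain ⟨i, hi, h1, h2⟩ := hX x hxX
      rcases Nat.lt_succ_iff_lt_or_eq.1 hi with hi | rfl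
      · exact ⟨i, hi, h1, h2⟩
      · exact absurd (mem_innerPart.2 ⟨hxX, h1, h2⟩) hxn
    have hRXl' := hearly RX hRX
    have hFXl' := hearly FX hFX
    -- such an edge lies inside `vertsUpTo k` and is not a slot of gadget `k`
    have hinside : ∀ x : α × α, (∃ i < k, x.1 ∈ 𝒢.VX i ∧ x.2 ∈ 𝒢.VX i) →
        x.1 ∈ vertsUpTo V 𝒢 k ∧ x.2 ∈ vertsUpTo V 𝒢 k ∧ ¬ slotOf (𝒢.S k) x.1 x.2 := by
      rintro x ⟨i, hi, h1, h2⟩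
      refine ⟨mem_vertsUpTo_iff.2 (Or.inr ⟨i, hi, h1⟩), mem_vertsUpTo_iff.2 (Or.inr ⟨i, hi, h2⟩), fun hsl => ?_⟩
      have hx1V : x.1 ∈ V := by
        rcases hsl with he | he
        · exact (hv.slot_adj k hk' _ he).1
        · exact (hv.slot_adj k hk' _ he).2.1
      exact Finset.disjoint_left.1 (hv.V_disjoint i (by omega)) hx1V h1
    have hsubR : RXk ⊆ RX := by rw [hRXk]; exact Finset.filter_subset _ _
    have hsubF : FXk ⊆ FX := by rw [hFXk]; exact Finset.filter_subset _ _
    have hRU : R ∪ RX = (R ∪ RXl) ∪ RXk := by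
      rw [Finset.union_assoc, hRXl, Finset.sdiff_union_of_subset hsubR]
    have hFU : F ∪ FX = (F ∪ FXl) ∪ FXk := by
      rw [Finset.union_assoc, hFXl, Finset.sdiff_union_of_subset hsubF]
    rw [show vertsUpTo V 𝒢 (k + 1) = vertsUpTo V 𝒢 k ∪ 𝒢.VX k by
      simp [vertsUpTo, Finset.range_add_one, Finset.biUnion_insert, Finset.union_comm, Finset.union_assoc]]
    rw [hRU, hFU, hsub.hamCountRF_eq_sum_refined (mem_vertsUpTo_iff.2 (Or.inl hs)) (mem_vertsUpTo_iff.2 (Or.inl ht))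
      (fun e he => ?_) (fun e he => ?_)
      (fun x hx => (mem_innerPart.1 hx).2) (fun x hx => (mem_innerPart.1 hx).2)]
    rotate_left
    · rcases Finset.mem_union.1 he with he | he
      · exact ⟨mem_vertsUpTo_iff.2 (Or.inl (hR e he).1), mem_vertsUpTo_iff.2 (Or.inl (hR e he).2.1),
          (hR e he).2.2 k (Nat.lt_succ_self k)⟩
      · exact hinside e (hRXl' e he)
    · rcases Finset.mem_union.1 he with he | he
      · exact ⟨mem_vertsUpTo_iff.2 (Or.inl (hF e he).1), mem_vertsUpTo_iff.2 (Or.inl (hF e he).2.1),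
          (hF e he).2.2 k (Nat.lt_succ_self k)⟩
      · exact hinside e (hFXl' e he)
    -- apply the induction hypothesis to each term
    have hterm : ∀ U' ∈ (𝒢.S k).powerset,
        hamCountRF (graphUpTo M V 𝒢 k) (vertsUpTo V 𝒢 k) s t (R ∪ RXl ∪ U') (F ∪ FXl ∪ (𝒢.S k \ U')) =
          ∑ U ∈ (slotsBelow 𝒢 k).powerset,
            (∏ i ∈ Finset.range k, coverCountRF (𝒢.GX i) (𝒢.VX i) (U ∩ 𝒢.S i)
                (innerPart (𝒢.VX i) RXl) (innerPart (𝒢.VX i) FXl)) *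
              hamCountRF M V s t (R ∪ U' ∪ U) (F ∪ (𝒢.S k \ U') ∪ (slotsBelow 𝒢 k \ U)) := by
      intro U' hU'
      rw [Finset.mem_powerset] at hU'
      have hslot : ∀ e ∈ 𝒢.S k, e.1 ∈ V ∧ e.2 ∈ V ∧ ∀ i < k, ¬ slotOf (𝒢.S i) e.1 e.2 := fun e he =>
        ⟨(hv.slot_adj k hk' e he).1, (hv.slot_adj k hk' e he).2.1,
          fun i hi => hv.slot_across k hk' i (by omega) (by omega) e he⟩
      have h1 : R ∪ RXl ∪ U' = (R ∪ U') ∪ RXl := by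
        ext e; simp only [Finset.mem_union]; tauto
      have h2 : F ∪ FXl ∪ (𝒢.S k \ U') = (F ∪ (𝒢.S k \ U')) ∪ FXl := by
        ext e; simp only [Finset.mem_union]; tauto
      rw [h1, h2]
      refine ih (by omega) (R ∪ U') (F ∪ (𝒢.S k \ U')) RXl FXl (fun e he => ?_) (fun e he => ?_) hRXl' hFXl'
      · rcases Finset.mem_union.1 he with he | he
        · exact ⟨(hR e he).1, (hR e he).2.1, fun i hi => (hR e he).2.2 i (by omega)⟩
        · exact hslot e (hU' he)
      · rcases Finset.mem_union.1 he with he | he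
        · exact ⟨(hF e he).1, (hF e he).2.1, fun i hi => (hF e he).2.2 i (by omega)⟩
        · exact hslot e (Finset.mem_sdiff.1 he).1
    rw [Finset.sum_congr rfl fun U' hU' => by rw [hterm U' hU']]
    -- inner parts seen by the earlier gadgets are unchanged by removing gadget `k`'s part
    have hXearly : ∀ X : Finset (α × α), ∀ i < k,
        innerPart (𝒢.VX i) (X \ innerPart (𝒢.VX k) X) = innerPart (𝒢.VX i) X := by
      intro X i hi
      ext x
      simp only [mem_innerPart, Finset.mem_sdiff]
      constructor
      · rintro ⟨⟨hx, -⟩, h1, h2⟩; exact ⟨hx, h1, h2⟩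
      · rintro ⟨hx, h1, h2⟩
        refine ⟨⟨hx, fun hk2 => ?_⟩, h1, h2⟩
        exact Finset.disjoint_left.1 (hv.VX_disjoint i (by omega) k hk' (by omega)) h1 hk2.2.1
    -- regroup the double sum as a sum over the subsets of `slotsBelow (k+1) = slotsBelow k ∪ S k`
    have hdisj : Disjoint (slotsBelow 𝒢 k) (𝒢.S k) := by
      rw [Finset.disjoint_left]
      intro e he he'
      obtain ⟨i, hi, hei⟩ := mem_slotsBelow_iff.1 he
      exact hv.slot_across i (by omega) k hk' (by omega) e hei (Or.inl he')
    have hbelow : slotsBelow 𝒢 (k + 1) = slotsBelow 𝒢 k ∪ 𝒢.S k := by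
      simp [slotsBelow, Finset.range_add_one, Finset.biUnion_insert, Finset.union_comm]
    rw [hbelow, sum_powerset_union_of_disjoint hdisj, Finset.sum_comm]
    refine Finset.sum_congr rfl fun U' hU' => ?_
    rw [Finset.mul_sum]
    refine Finset.sum_congr rfl fun U hU => ?_
    rw [Finset.mem_powerset] at hU hU'
    have hXS : (U ∪ U') ∩ 𝒢.S k = U' := by
      ext e
      simp only [Finset.mem_inter, Finset.mem_union]
      constructor
      · rintro ⟨he | he, heS⟩
        · exact absurd heS (Finset.disjoint_left.1 hdisj (hU he))
        · exact he
      · exact fun he => ⟨Or.inr he, hU' he⟩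
    have hXi : ∀ i ∈ Finset.range k, (U ∪ U') ∩ 𝒢.S i = U ∩ 𝒢.S i := by
      intro i hi
      rw [Finset.mem_range] at hi
      ext e
      simp only [Finset.mem_inter, Finset.mem_union]
      constructor
      · rintro ⟨he | he, heS⟩
        · exact ⟨he, heS⟩
        · exact absurd (Or.inl heS : slotOf (𝒢.S i) e.1 e.2) (hv.slot_across k hk' i (by omega) (by omega) e (hU' he))
      · rintro ⟨he, heS⟩
        exact ⟨Or.inl he, heS⟩
    rw [Finset.prod_range_succ, hXS,
      Finset.prod_congr (s₂ := Finset.range k)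
        (f := fun i => coverCountRF (𝒢.GX i) (𝒢.VX i) ((U ∪ U') ∩ 𝒢.S i) (innerPart (𝒢.VX i) RX) (innerPart (𝒢.VX i) FX))
        (g := fun i => coverCountRF (𝒢.GX i) (𝒢.VX i) (U ∩ 𝒢.S i) (innerPart (𝒢.VX i) RXl) (innerPart (𝒢.VX i) FXl))
        rfl fun i hi => by
          rw [Finset.mem_range] at hi
          simp only [hXi i (Finset.mem_range.2 hi), hRXl, hFXl, hRXk, hFXk, hXearly RX i hi, hXearly FX i hi]]
    have hRU' : R ∪ U' ∪ U = R ∪ (U ∪ U') := by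
      ext e; simp only [Finset.mem_union]; tauto
    have hFU' : F ∪ (𝒢.S k \ U') ∪ (slotsBelow 𝒢 k \ U) = F ∪ ((slotsBelow 𝒢 k ∪ 𝒢.S k) \ (U ∪ U')) := by
      ext e
      simp only [Finset.mem_union, Finset.mem_sdiff, not_or]
      constructor
      · rintro ((he | ⟨he, hne⟩) | ⟨he, hne⟩)
        · exact Or.inl he
        · exact Or.inr ⟨Or.inr he, fun h => Finset.disjoint_left.1 hdisj (hU h) he, hne⟩
        · exact Or.inr ⟨Or.inl he, hne, fun h => Finset.disjoint_left.1 hdisj he (hU' h)⟩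
      · rintro (he | ⟨he | he, hne, hne'⟩)
        · exact Or.inl (Or.inl he)
        · exact Or.inr ⟨he, hne⟩
        · exact Or.inl (Or.inr ⟨he, hne'⟩)
    rw [hRU', hFU']
    ring

/-- The unconstrained form of the refined identity for `k ≤ n` gadgets, with inner constraints
only: `#Ham(graphUpTo k, RX, FX) = Σ_U (∏ N_i(U ∩ S_i; RX|_i, FX|_i)) · #Ham(M, U, slots \ U)`.
[cite: GareyJohnson1979, §3.2.2] -/
theorem Valid.hamCountRF_graphUpTo_refined_inner {n : ℕ} (hv : Valid M V 𝒢 n) {s t : α} (hs : s ∈ V) (ht : t ∈ V)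
    {k : ℕ} (hk : k ≤ n) {RX FX : Finset (α × α)}
    (hRX : ∀ x ∈ RX, ∃ i < k, x.1 ∈ 𝒢.VX i ∧ x.2 ∈ 𝒢.VX i)
    (hFX : ∀ x ∈ FX, ∃ i < k, x.1 ∈ 𝒢.VX i ∧ x.2 ∈ 𝒢.VX i) :
    hamCountRF (graphUpTo M V 𝒢 k) (vertsUpTo V 𝒢 k) s t RX FX =
      ∑ U ∈ (slotsBelow 𝒢 k).powerset,
        (∏ i ∈ Finset.range k, coverCountRF (𝒢.GX i) (𝒢.VX i) (U ∩ 𝒢.S i)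
            (innerPart (𝒢.VX i) RX) (innerPart (𝒢.VX i) FX)) *
          hamCountRF M V s t U (slotsBelow 𝒢 k \ U) := by
  have := hv.hamCountRF_graphUpTo_refined hs ht k hk ∅ ∅ RX FX (by simp) (by simp) hRX hFX
  simpa using this

end GadgetFamily

end Literature.Combinatorics.SimpleGraph
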